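import Literature.Geometry.Lorentzian.PlaneWaveExterior
import Literature.Geometry.Lorentzian.GowdyAxisMean
import Mathlib.Analysis.SpecialFunctions.SmoothTransition
import Mathlib.Analysis.SpecialFunctions.Log.Deriv
import Mathlib.Analysis.InnerProductSpace.Calculus
import HarnessLib

/-!
# The Gowdy pulse I: the profile, the axis mean `P`, its Kasner and flat regions

Support file (everything proved, no named facts) for the explicit vacuum spacetime of
`Literature.Geometry.Lorentzian.christodoulou_trapped_surface_formation_holds`.

We fix the even smooth datum `g(r) = (1 − χ(r)) log|r|`, `χ(r) = smoothTransition((4 − r²)/3)`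
(`χ = 1` on `[−1, 1]`, `χ = 0` outside `(−2, 2)`), its Schlömilch transform `β = B[g]`
(`Schloemilch.schB`: smooth, even, `β = 0` on `[−1, 1]`, `S[β] = g`), and the polarized Gowdy
potential **`P(t, θ) = (2π)⁻¹ ∫₀^{2π} β(θ + t cos o) do`** (`Gowdy.axisMean`, a smooth solution of
`P_tt + P_t/t = P_θθ`, `GowdyAxisMean.lean`). Then:

* `P = 0` on the diamond `|t| + |θ| ≤ 1` (`Pulse.P2_eq_zero`: all arguments lie in `[−1, 1]`) —
  the **Kasner region**;
* `P = log t` on `{t > 2 + |θ|}` (`Pulse.P2_eq_log`) — the **flat region**: `P(t, θ)` is the value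
  at `(T, x) = (θ, (t, 0))` of the plane-wave superposition `W` of `PlaneWaveExterior.lean`,
  whose Cauchy datum is `S[β](‖x‖) = g(‖x‖) = log ‖x‖` for `‖x‖ ≥ 2`; `log ‖x‖` is harmonic, so
  `W = log ‖x‖` outside the light cone of the disc `‖x‖ ≤ 2` (`PlaneWave.W_eq_of_exterior`,
  energy method / domain of dependence).

The first derivatives of `P` in both regions are recorded (`fderiv_P2_of_flat`,
`fderiv_P2_of_diamond`). The conformal factor `λ` and the Gowdy data follow in
`GowdyPulseLambda.lean`. (Construction in the spirit of the polarized Gowdy / Einstein–Rosen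
solutions of Gowdy 1974 and Isenberg–Moncrief 1990, glued from exact Kasner and flat pieces by
finite speed of propagation.)

## References

* J. Isenberg, V. Moncrief, Ann. Phys. 199 (1990) 84–122, (3)–(5). [IsenbergMoncrief1990]
* E. T. Whittaker, G. N. Watson, *A Course of Modern Analysis*, §11.81, §18.61. [WhittakerWatson1927]
* L. C. Evans, *Partial Differential Equations*, §2.4.3. [Evans2010]
-/

noncomputable section

open Set Filter MeasureTheory intervalIntegral Real
open scoped Topology ContDiff

namespace Literature.Geometry.Lorentzian

namespace Pulse

open Literature.Analysis.FunctionSpaces WaveCone Schloemilch PlaneWave Gowdy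

/-! ### The cut-off and the datum `g` -/

/-- The even cut-off `χ(r) = smoothTransition((4 − r²)/3)`: `χ = 1` on `[−1, 1]`, `χ = 0` for
`|r| ≥ 2`. [folklore] -/
def chi (r : ℝ) : ℝ := Real.smoothTransition ((4 - r ^ 2) / 3)

/-- The datum `g(r) = (1 − χ(r)) log |r|` (Mathlib's `Real.log` is even). [folklore] -/
def gfun (r : ℝ) : ℝ := (1 - chi r) * Real.log r

/-- `χ` is smooth. [folklore] -/
theorem contDiff_chi : ContDiff ℝ ∞ chi := by
  unfold chi
  exact (Real.smoothTransition.contDiff (n := ⊤)).comp (by fun_prop)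

/-- `χ = 1` on `[−1, 1]`. [folklore] -/
theorem chi_of_abs_le_one {r : ℝ} (hr : |r| ≤ 1) : chi r = 1 := by
  unfold chi
  apply Real.smoothTransition.one_of_one_le
  have : r ^ 2 ≤ 1 := by
    have h := abs_le.1 hr
    nlinarith
  linarith

/-- `χ = 0` for `|r| ≥ 2`. [folklore] -/
theorem chi_of_two_le_abs {r : ℝ} (hr : 2 ≤ |r|) : chi r = 0 := by
  unfold chi
  apply Real.smoothTransition.zero_of_nonpos
  have : 4 ≤ r ^ 2 := by
    have h : (2 : ℝ) ^ 2 ≤ |r| ^ 2 := by gcongr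
    rw [sq_abs] at h
    linarith
  linarith

/-- `χ` is even. [folklore] -/
theorem chi_neg (r : ℝ) : chi (-r) = chi r := by simp [chi]

/-- `g = 0` on `[−1, 1]`. [folklore] -/
theorem gfun_of_abs_le_one {r : ℝ} (hr : |r| ≤ 1) : gfun r = 0 := by
  simp [gfun, chi_of_abs_le_one hr]

/-- `g(r) = log |r|` for `|r| ≥ 2`. [folklore] -/
theorem gfun_of_two_le_abs {r : ℝ} (hr : 2 ≤ |r|) : gfun r = Real.log |r| := by
  simp [gfun, chi_of_two_le_abs hr, Real.log_abs]

/-- `g` is even. [folklore] -/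
theorem gfun_neg (r : ℝ) : gfun (-r) = gfun r := by
  simp [gfun, chi_neg, Real.log_neg_eq_log]

/-- `g 0 = 0`. [folklore] -/
theorem gfun_zero : gfun 0 = 0 := gfun_of_abs_le_one (by simp)

/-- `g` is smooth (it vanishes identically near `0`, and is a product of smooth functions away
from `0`). [folklore] -/
theorem contDiff_gfun : ContDiff ℝ ∞ gfun := by
  rw [contDiff_iff_contDiffAt]
  intro r
  by_cases hr : r = 0
  · subst hr
    have hev : gfun =ᶠ[𝓝 (0 : ℝ)] fun _ ↦ 0 := by
      have : Ioo (-1 : ℝ) 1 ∈ 𝓝 (0 : ℝ) := Ioo_mem_nhds (by norm_num) (by norm_num)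
      filter_upwards [this] with s hs
      exact gfun_of_abs_le_one (abs_le.2 ⟨hs.1.le, hs.2.le⟩)
    exact (contDiffAt_const (c := (0 : ℝ))).congr_of_eventuallyEq hev
  · unfold gfun
    exact ((contDiff_const.sub contDiff_chi).contDiffAt).mul (Real.contDiffAt_log.2 hr)

/-! ### The profile `β` -/

/-- **The plane-wave profile** `β = B[g]`, Schlömilch's transform of `g`. [cite: WhittakerWatson1927, §11.81] -/
def beta : ℝ → ℝ := schB gfun

/-- `β` is smooth. [folklore] -/
theorem contDiff_beta : ContDiff ℝ ∞ beta := contDiff_schB contDiff_gfun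

/-- `β` is even. [folklore] -/
theorem beta_neg (s : ℝ) : beta (-s) = beta s := schB_neg gfun_neg s

/-- `β = 0` on `[−1, 1]` (`g` is constant there). [folklore] -/
theorem beta_of_abs_le_one {s : ℝ} (hs : |s| ≤ 1) : beta s = 0 :=
  schB_eq_of_const contDiff_gfun (k := 0) (R := 1) one_pos (fun _ hx ↦ gfun_of_abs_le_one hx) s hs

/-- **Schlömilch's equation**: `S[β] = g`. [cite: WhittakerWatson1927, §11.81] -/
theorem schS_beta (r : ℝ) : schS beta r = gfun r := schS_schB contDiff_gfun r

/-! ### The potential `P` and its Kasner region -/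

/-- **The polarized Gowdy potential** `P(t, θ) = (2π)⁻¹ ∫₀^{2π} β(θ + t cos o) do` as a
function of `(t, θ)`. [cite: IsenbergMoncrief1990, (4)] -/
def P2 : ℝ × ℝ → ℝ := axisMean beta

/-- `P` is smooth on `ℝ²`. [folklore] -/
theorem contDiff_P2 : ContDiff ℝ ∞ P2 := contDiff_axisMean contDiff_beta

/-- **`P` solves the polarized Gowdy equation** `P_tt + P_t/t = P_θθ` for `t ≠ 0`.
[cite: IsenbergMoncrief1990, (4)] -/
theorem epd_P2 (q : ℝ × ℝ) (hq : q.1 ≠ 0) :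
    fderiv ℝ (fun p ↦ fderiv ℝ P2 p ((1 : ℝ), (0 : ℝ))) q ((1 : ℝ), (0 : ℝ)) +
        fderiv ℝ P2 q ((1 : ℝ), (0 : ℝ)) / q.1 =
      fderiv ℝ (fun p ↦ fderiv ℝ P2 p ((0 : ℝ), (1 : ℝ))) q ((0 : ℝ), (1 : ℝ)) :=
  epd_axisMean contDiff_beta q hq

/-- **The Kasner region**: `P = 0` on the closed diamond `|t| + |θ| ≤ 1`. [folklore] -/
theorem P2_eq_zero (q : ℝ × ℝ) (hq : |q.1| + |q.2| ≤ 1) : P2 q = 0 :=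
  axisMean_eq_of_const (k := 0) (R := 1) (fun _ hτ ↦ beta_of_abs_le_one hτ) q hq

/-- The open diamond `|t| + |θ| < 1`. [folklore] -/
def diamond : Set (ℝ × ℝ) := {q | |q.1| + |q.2| < 1}

/-- The diamond is open. [folklore] -/
theorem isOpen_diamond : IsOpen diamond :=
  isOpen_lt (by fun_prop) continuous_const

/-- **On the open diamond `P` has vanishing derivative.** [folklore] -/
theorem fderiv_P2_of_diamond {q : ℝ × ℝ} (hq : q ∈ diamond) : fderiv ℝ P2 q = 0 := by
  have hev : P2 =ᶠ[𝓝 q] fun _ ↦ 0 :=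
    Filter.eventually_of_mem (isOpen_diamond.mem_nhds hq) fun p hp ↦ P2_eq_zero p (le_of_lt hp)
  rw [hev.fderiv_eq, fderiv_fun_const]; rfl

/-! ### The harmonic exterior datum `G(x) = g(‖x‖)` on `ℝ²` -/

/-- The Cauchy datum on the plane: `G(x) = g(‖x‖)`. [folklore] -/
def G (x : E2) : ℝ := gfun ‖x‖

/-- `G = 0` on the unit disc. [folklore] -/
theorem G_of_norm_le_one {x : E2} (hx : ‖x‖ ≤ 1) : G x = 0 :=
  gfun_of_abs_le_one (by rwa [abs_norm])

/-- `G(x) = log ‖x‖ = ½ log(x₁² + x₂²)` for `‖x‖ ≥ 2`. [folklore] -/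
theorem G_of_two_le {x : E2} (hx : 2 ≤ ‖x‖) : G x = 2⁻¹ * Real.log (x 0 ^ 2 + x 1 ^ 2) := by
  unfold G
  rw [gfun_of_two_le_abs (by rwa [abs_norm]), abs_norm]
  have h : ‖x‖ = √(x 0 ^ 2 + x 1 ^ 2) := by
    rw [EuclideanSpace.norm_eq, Fin.sum_univ_two]
    simp [sq_abs]
  rw [h, Real.log_sqrt (by positivity)]
  ring

/-- `G` is smooth: near `0` it vanishes, away from `0` the norm is smooth. [folklore] -/
theorem contDiff_G : ContDiff ℝ ∞ G := by
  rw [contDiff_iff_contDiffAt]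
  intro x
  by_cases hx : x = 0
  · subst hx
    have hev : G =ᶠ[𝓝 (0 : E2)] fun _ ↦ 0 := by
      have : Metric.ball (0 : E2) 1 ∈ 𝓝 (0 : E2) := Metric.ball_mem_nhds 0 one_pos
      filter_upwards [this] with y hy
      exact G_of_norm_le_one (by simpa using (Metric.mem_ball.1 hy).le)
    exact (contDiffAt_const (c := (0 : ℝ))).congr_of_eventuallyEq hev
  · exact contDiff_gfun.contDiffAt.comp x (contDiffAt_norm ℝ hx)

/-- The squared norm `s(x) = x₁² + x₂²` and its derivative. [folklore] -/
theorem hasFDerivAt_normSq (x : E2) :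
    HasFDerivAt (fun y : E2 ↦ y 0 ^ 2 + y 1 ^ 2)
      ((2 * x 0) • (EuclideanSpace.proj (0 : Fin 2) : E2 →L[ℝ] ℝ) +
        (2 * x 1) • (EuclideanSpace.proj (1 : Fin 2) : E2 →L[ℝ] ℝ)) x := by
  have h0 := ((EuclideanSpace.proj (0 : Fin 2) : E2 →L[ℝ] ℝ).hasFDerivAt (x := x)).pow 2
  have h1 := ((EuclideanSpace.proj (1 : Fin 2) : E2 →L[ℝ] ℝ).hasFDerivAt (x := x)).pow 2
  refine (h0.add h1).congr_fderiv ?_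
  ext v
  simp [two_mul]

/-- The logarithmic potential `L(x) = ½ log(x₁² + x₂²)` has gradient `x/(x₁² + x₂²)`. [folklore] -/
theorem hasFDerivAt_logPot {x : E2} (hx : x 0 ^ 2 + x 1 ^ 2 ≠ 0) :
    HasFDerivAt (fun y : E2 ↦ 2⁻¹ * Real.log (y 0 ^ 2 + y 1 ^ 2))
      ((2⁻¹ : ℝ) • ((x 0 ^ 2 + x 1 ^ 2)⁻¹ • ((2 * x 0) • (EuclideanSpace.proj (0 : Fin 2) : E2 →L[ℝ] ℝ) +
        (2 * x 1) • (EuclideanSpace.proj (1 : Fin 2) : E2 →L[ℝ] ℝ)))) x := by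
  have h := ((Real.hasDerivAt_log hx).comp_hasFDerivAt x (hasFDerivAt_normSq x)).const_mul 2⁻¹
  simpa [Function.comp_def] using h

/-- The partial derivatives of the logarithmic potential: `∂ⱼ L = xⱼ/(x₁² + x₂²)`. [folklore] -/
theorem fderiv_logPot_single {x : E2} (hx : x 0 ^ 2 + x 1 ^ 2 ≠ 0) (j : Fin 2) :
    fderiv ℝ (fun y : E2 ↦ 2⁻¹ * Real.log (y 0 ^ 2 + y 1 ^ 2)) x (EuclideanSpace.single j (1 : ℝ)) =
      x j * (x 0 ^ 2 + x 1 ^ 2)⁻¹ := by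
  rw [(hasFDerivAt_logPot hx).fderiv]
  fin_cases j
  · simp; field_simp
  · simp; field_simp

/-- The inverse squared norm and its derivative. [folklore] -/
theorem hasFDerivAt_inv_normSq {x : E2} (hx : x 0 ^ 2 + x 1 ^ 2 ≠ 0) :
    HasFDerivAt (fun y : E2 ↦ (y 0 ^ 2 + y 1 ^ 2)⁻¹)
      ((-(((x 0 ^ 2 + x 1 ^ 2) ^ 2)⁻¹)) • ((2 * x 0) • (EuclideanSpace.proj (0 : Fin 2) : E2 →L[ℝ] ℝ) +
        (2 * x 1) • (EuclideanSpace.proj (1 : Fin 2) : E2 →L[ℝ] ℝ))) x :=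
  (hasDerivAt_inv hx).comp_hasFDerivAt x (hasFDerivAt_normSq x)

/-- The second partials `∂ⱼ (xⱼ / s) = 1/s − 2xⱼ²/s²`. [folklore] -/
theorem hasFDerivAt_coord_div_normSq (x : E2) (hx : x 0 ^ 2 + x 1 ^ 2 ≠ 0) (j : Fin 2) :
    fderiv ℝ (fun y : E2 ↦ y j * (y 0 ^ 2 + y 1 ^ 2)⁻¹) x (EuclideanSpace.single j (1 : ℝ)) =
      (x 0 ^ 2 + x 1 ^ 2)⁻¹ - 2 * x j ^ 2 * ((x 0 ^ 2 + x 1 ^ 2) ^ 2)⁻¹ := by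
  have hnum := (EuclideanSpace.proj j : E2 →L[ℝ] ℝ).hasFDerivAt (x := x)
  have h := hnum.fun_mul (hasFDerivAt_inv_normSq hx)
  have hfd : fderiv ℝ (fun y : E2 ↦ y j * (y 0 ^ 2 + y 1 ^ 2)⁻¹) x = _ := h.fderiv
  rw [hfd]
  fin_cases j
  · simp; ring
  · simp; ring

/-- The exterior region `{‖x‖ > 2}` is open. [folklore] -/
theorem isOpen_exterior : IsOpen {x : E2 | 2 < ‖x‖} := isOpen_lt continuous_const continuous_norm

/-- On the exterior region, `x₁² + x₂² ≠ 0`. [folklore] -/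
theorem normSq_ne_zero {x : E2} (hx : 2 < ‖x‖) : x 0 ^ 2 + x 1 ^ 2 ≠ 0 := by
  have h : ‖x‖ ^ 2 = x 0 ^ 2 + x 1 ^ 2 := by
    rw [EuclideanSpace.real_norm_sq_eq, Fin.sum_univ_two]
  rw [← h]
  positivity

/-- **`G` is harmonic on `{‖x‖ > 2}`**: `ΔG = Δ log‖x‖ = 0` there. [folklore] -/
theorem laplacian_G {x : E2} (hx : 2 < ‖x‖) :
    ∑ j, fderiv ℝ (fun y ↦ fderiv ℝ G y (EuclideanSpace.single j (1 : ℝ))) x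
      (EuclideanSpace.single j (1 : ℝ)) = 0 := by
  -- `G = L` near every exterior point, hence `∂ⱼ G = ∂ⱼ L = xⱼ/s` on the exterior
  have hGL : ∀ y : E2, 2 < ‖y‖ →
      fderiv ℝ G y = fderiv ℝ (fun z : E2 ↦ 2⁻¹ * Real.log (z 0 ^ 2 + z 1 ^ 2)) y := by
    intro y hy
    have hev : G =ᶠ[𝓝 y] fun z : E2 ↦ 2⁻¹ * Real.log (z 0 ^ 2 + z 1 ^ 2) :=
      Filter.eventually_of_mem (isOpen_exterior.mem_nhds hy) fun z hz ↦ G_of_two_le (le_of_lt hz)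
    exact hev.fderiv_eq
  have hj : ∀ j : Fin 2, (fun y ↦ fderiv ℝ G y (EuclideanSpace.single j (1 : ℝ))) =ᶠ[𝓝 x]
      fun y : E2 ↦ y j * (y 0 ^ 2 + y 1 ^ 2)⁻¹ := by
    intro j
    refine Filter.eventually_of_mem (isOpen_exterior.mem_nhds hx) fun y hy ↦ ?_
    simp only
    rw [hGL y hy, fderiv_logPot_single (normSq_ne_zero hy)]
  rw [Fin.sum_univ_two, (hj 0).fderiv_eq, (hj 1).fderiv_eq,
    hasFDerivAt_coord_div_normSq x (normSq_ne_zero hx) 0,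
    hasFDerivAt_coord_div_normSq x (normSq_ne_zero hx) 1]
  have hs := normSq_ne_zero hx
  field_simp
  ring

/-! ### The flat region of `P` -/

/-- **The plane-wave superposition of `β` is `log ‖x‖` outside the light cone of the disc
`‖x‖ ≤ 2`.** [cite: Evans2010, §2.4.3, Thm 6] -/
theorem W_beta_eq (T : ℝ) (x : E2) (hx : 2 + |T| < ‖x‖) : PlaneWave.W beta (T, x) = G x :=
  W_eq_of_exterior contDiff_beta beta_neg contDiff_G (R₀ := 2) (fun _ hy ↦ laplacian_G hy)
    (fun _ _ ↦ schS_beta _) T x hx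

/-- `P(t, θ)` is the value of the plane-wave superposition at `(T, x) = (θ, (t, 0))`. [folklore] -/
theorem P2_eq_W (t θ : ℝ) : P2 (t, θ) = PlaneWave.W beta (θ, EuclideanSpace.single 0 t) := by
  rw [P2, axisMean_eq, W_eq]
  congr 1
  refine intervalIntegral.integral_congr fun o _ ↦ ?_
  simp [PlaneWave.lin]

/-- The flat region `{t > 2 + |θ|}`. [folklore] -/
def flat : Set (ℝ × ℝ) := {q | 2 + |q.2| < q.1}

/-- The flat region is open. [folklore] -/
theorem isOpen_flat : IsOpen flat := isOpen_lt (by fun_prop) continuous_fst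

/-- **The flat region**: `P(t, θ) = log t` for `t > 2 + |θ|`. [folklore] -/
theorem P2_eq_log {q : ℝ × ℝ} (hq : q ∈ flat) : P2 q = Real.log q.1 := by
  obtain ⟨t, θ⟩ := q
  simp only [flat, mem_setOf_eq] at hq
  have ht : 0 < t := by linarith [abs_nonneg θ]
  have hnorm : ‖(EuclideanSpace.single (0 : Fin 2) t : E2)‖ = t := by
    rw [EuclideanSpace.norm_eq, Fin.sum_univ_two]
    simp [abs_of_pos ht, Real.sqrt_sq ht.le]
  rw [P2_eq_W, W_beta_eq θ _ (by rw [hnorm]; linarith), G, hnorm,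
    gfun_of_two_le_abs (by rw [abs_of_pos ht]; linarith [abs_nonneg θ]), abs_of_pos ht]

/-- **On the flat region `∇P = (1/t, 0)`.** [folklore] -/
theorem fderiv_P2_of_flat {q : ℝ × ℝ} (hq : q ∈ flat) :
    fderiv ℝ P2 q = (q.1)⁻¹ • ContinuousLinearMap.fst ℝ ℝ ℝ := by
  have ht : q.1 ≠ 0 := by
    have := hq; simp only [flat, mem_setOf_eq] at this; linarith [abs_nonneg q.2]
  have hev : P2 =ᶠ[𝓝 q] fun p ↦ Real.log p.1 :=
    Filter.eventually_of_mem (isOpen_flat.mem_nhds hq) fun p hp ↦ P2_eq_log hp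
  rw [hev.fderiv_eq]
  have h1 := (Real.hasDerivAt_log ht).comp_hasFDerivAt q (hasFDerivAt_fst (𝕜 := ℝ) (E := ℝ) (F := ℝ) (p := q))
  have hfd : fderiv ℝ (fun p : ℝ × ℝ ↦ Real.log p.1) q = _ := h1.fderiv
  rw [hfd]

/-- On the flat region `P_t = 1/t`. [folklore] -/
theorem fderiv_P2_t_of_flat {q : ℝ × ℝ} (hq : q ∈ flat) : fderiv ℝ P2 q ((1 : ℝ), (0 : ℝ)) = (q.1)⁻¹ := by
  rw [fderiv_P2_of_flat hq]; simp

/-- On the flat region `P_θ = 0`. [folklore] -/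
theorem fderiv_P2_θ_of_flat {q : ℝ × ℝ} (hq : q ∈ flat) : fderiv ℝ P2 q ((0 : ℝ), (1 : ℝ)) = 0 := by
  rw [fderiv_P2_of_flat hq]; simp

end Pulse

end Literature.Geometry.Lorentzian
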